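import Literature.Computability.QuantumComplexity.SegmentLayout
import Literature.Computability.QuantumComplexity.OracleXorRegister
import Literature.Computability.Cryptography.VanDamSeroussiOracle2
import HarnessLib

/-!
# The van Dam–Seroussi copy, I: parameters, registers, oracle blocks and their layout

Topic `Literature/Computability/Cryptography`; layer C′ of the discharge of
`VanDamSeroussi2002_gaussSumPhase_qsolvable` (van Dam–Seroussi 2002, §4 Algorithm 1 / Thm. 1, in the
gadget-free realisation recorded in `ShiftModes.lean`: every classical step an oracle-answered XOR
block over the language `VDSOracle.lang₂`, the character phases by kick-back on a mode register,
the Fourier read-out by Kitaev's eigenvalue measurement of the shift). This file fixes, for an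
instance `(p, g, a, b)` and a precision parameter `prec`:

* the sizes `VDSCopy.Prm.n, c, LvE, BE, kE, mR, Nz, LvZ, BZ, kZ, Wf` (all polynomial in `|bin p|`);
* the 22 registers `VDSCopy.R` and their widths `wd`;
* the 26 oracle XOR blocks `VDSCopy.ops` (kind, block-size field `L`, source registers `r₁`, `r₂`,
  target register) — the classical steps of the copy in the order they are applied
  (`Fc ← FACT`, the shift/un-shift pair of the mode measurement, `U ← RECONP`, the preparation
  `Y, Qj ← T`, `T ← 0`, `D ← DLOG(Y)`, the kick-back `Bv ← ADDEND`, `E3 ← E2 + Bv`, `E2 ← 0`, erasures,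
  the periodisation `Z ← Y + pJ`, `Y, J ← 0`, the shift pair of the Fourier read-out, `K ← RECONK`,
  the un-phase kick-back, and `Db ← DLOG(b)`);
* the constant HEADER string of gate `i` of block `o`, `hdrStr` — the query prefix
  `encodeQ (xOf p g a b) tag i L w₁ []` (`encodeQ_append`: query = header ++ register bits);
* the segment list `segs` (register widths, then one segment per header) on `b = segs.sum` wires,
  the register embeddings `reg`, source embeddings `src` (concatenated registers, `catEmb`), header
  embeddings `hdr`, and **`xblock o : OracleXor.XBlock b`** with its side conditions discharged by
  `SegLayout.emb_ne`.

Definitions with bodies and their bookkeeping lemmas; no named fact.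

## References

* W. van Dam, G. Seroussi, arXiv:quant-ph/0207131 (2002), §4 Algorithm 1, Thm. 1 [VanDamSeroussi2002].
* A. Yu. Kitaev, arXiv:quant-ph/9511026 (1995), §3, §5 [Kitaev1995].
* C. H. Bennett, E. Bernstein, G. Brassard, U. Vazirani, SIAM J. Comput. 26 (1997), Cor. 4.15 [BennettBernsteinBrassardVazirani1997].
-/

noncomputable section

namespace Literature.Computability.Cryptography

namespace VDSCopy

open _root_.Computability Complexity QuantumComplexity QuantumComplexity.SegLayout VDSOracle

/-! ### Concatenating disjoint embeddings -/

section Cat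

variable {N a₁ a₂ : ℕ}

/-- **Two disjoint embeddings side by side.** [folklore] -/
def catEmb (e₁ : Fin a₁ ↪ Fin N) (e₂ : Fin a₂ ↪ Fin N) (h : ∀ i j, e₁ i ≠ e₂ j) : Fin (a₁ + a₂) ↪ Fin N :=
  ⟨Fin.append e₁ e₂, by
    intro i i' hii'
    induction i using Fin.addCases with
    | left i =>
      induction i' using Fin.addCases with
      | left i' => rw [Fin.append_left, Fin.append_left] at hii'; rw [e₁.injective hii']
      | right j' => rw [Fin.append_left, Fin.append_right] at hii'; exact absurd hii' (h i j')
    | right j =>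
      induction i' using Fin.addCases with
      | left i' => rw [Fin.append_right, Fin.append_left] at hii'; exact absurd hii'.symm (h i' j)
      | right j' => rw [Fin.append_right, Fin.append_right] at hii'; rw [e₂.injective hii']⟩

/-- Reading along a concatenation reads the two parts. [folklore] -/
theorem ofFn_comp_catEmb (e₁ : Fin a₁ ↪ Fin N) (e₂ : Fin a₂ ↪ Fin N) (h : ∀ i j, e₁ i ≠ e₂ j) (x : QReg N) :
    List.ofFn (x ∘ catEmb e₁ e₂ h) = List.ofFn (x ∘ e₁) ++ List.ofFn (x ∘ e₂) := by
  rw [← List.ofFn_fin_append]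
  congr 1
  funext i
  simp only [Function.comp_apply, catEmb, Function.Embedding.coeFn_mk]
  induction i using Fin.addCases with
  | left i => rw [Fin.append_left, Fin.append_left]; rfl
  | right j => rw [Fin.append_right, Fin.append_right]; rfl

/-- The range of a concatenation. [folklore] -/
theorem catEmb_apply_eq (e₁ : Fin a₁ ↪ Fin N) (e₂ : Fin a₂ ↪ Fin N) (h : ∀ i j, e₁ i ≠ e₂ j) (i : Fin (a₁ + a₂)) :
    (∃ i₁, catEmb e₁ e₂ h i = e₁ i₁) ∨ ∃ i₂, catEmb e₁ e₂ h i = e₂ i₂ := by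
  simp only [catEmb, Function.Embedding.coeFn_mk]
  induction i using Fin.addCases with
  | left i => exact Or.inl ⟨i, Fin.append_left _ _ i⟩
  | right j => exact Or.inr ⟨j, Fin.append_right _ _ j⟩

end Cat

/-! ### Parameters -/

/-- The data of a copy: the instance `(p, g, a, b)` and the precision parameter. [cite: VanDamSeroussi2002, §4 Algorithm 1] -/
structure Prm where
  /-- the prime -/
  p : ℕ
  /-- the primitive root (any representative) -/
  g : ℕ
  /-- the exponent of the character -/
  a : ℕ
  /-- the twist -/
  b : ℕ
  /-- the precision parameter -/
  prec : ℕ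

namespace Prm

variable (P : Prm)

/-- Bits of values below `p`. [folklore] -/
def n : ℕ := Nat.size P.p
/-- Width of the preparation register `T`. [folklore] -/
def c : ℕ := P.n + 2 * P.prec + 2
/-- Levels of the mode measurement (`p · 5/16 < 2^{LvE − 1}`). [cite: Kitaev1995, §3 Lemma 10] -/
def LvE : ℕ := P.n + 1
/-- Repetitions per test block of the mode measurement. [cite: Kitaev1995, §3 (before Lemma 9)] -/
def BE : ℕ := 128 * P.LvE * 2 ^ (2 * P.prec)
/-- Controls of the mode measurement. [folklore] -/
def kE : ℕ := P.LvE * (2 * P.BE)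
/-- `R = 2^{mR}` repetitions of the periodisation. [cite: Hales2002, Ch. 5 §1 Algorithm 3] -/
def mR : ℕ := P.n + 4 + 2 * P.prec
/-- `Q = 2^{Nz}`, the modulus of the periodised register. [cite: Hales2002, Ch. 5 §1 Algorithm 3] -/
def Nz : ℕ := P.mR + 2 * P.n + P.prec + 3
/-- Levels of the Fourier read-out. [cite: Kitaev1995, §5] -/
def LvZ : ℕ := P.Nz + 1
/-- Repetitions per test block of the Fourier read-out. [folklore] -/
def BZ : ℕ := 128 * P.LvZ * 2 ^ (2 * P.prec)
/-- Controls of the Fourier read-out. [folklore] -/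
def kZ : ℕ := P.LvZ * (2 * P.BZ)
/-- Width of the certificate register (a bound on `|factCode p|`). [folklore] -/
def Wf : ℕ := 2 * (P.n + 1) ^ 2

end Prm

/-! ### Registers -/

/-- The 22 registers of a copy. [cite: VanDamSeroussi2002, §4 Algorithm 1] -/
inductive R
  | S | T | Y | Qj | D | Fc | E1 | E2 | TE | U | Bv | E3 | J | Z | Z2 | TZ | K | D2 | Bv2 | E4 | Db | Bc
  deriving DecidableEq

namespace R

/-- The segment index of a register. [folklore] -/
def idx : R → ℕ
  | S => 0 | T => 1 | Y => 2 | Qj => 3 | D => 4 | Fc => 5 | E1 => 6 | E2 => 7 | TE => 8 | U => 9 | Bv => 10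
  | E3 => 11 | J => 12 | Z => 13 | Z2 => 14 | TZ => 15 | K => 16 | D2 => 17 | Bv2 => 18 | E4 => 19 | Db => 20 | Bc => 21

/-- Segment indices are injective. [folklore] -/
theorem idx_injective : Function.Injective idx := by
  intro r r' h; cases r <;> cases r' <;> first | rfl | (simp [idx] at h)

/-- Register indices are below `22`. [folklore] -/
theorem idx_lt (r : R) : r.idx < 22 := by cases r <;> simp [idx]

/-- All registers, in index order. [folklore] -/
def all : List R := [S, T, Y, Qj, D, Fc, E1, E2, TE, U, Bv, E3, J, Z, Z2, TZ, K, D2, Bv2, E4, Db, Bc]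

end R

/-- **The register widths.** [cite: VanDamSeroussi2002, §4 Algorithm 1] -/
def wd (P : Prm) : R → ℕ
  | R.S => 1 | R.T => P.c | R.Y => P.n | R.Qj => P.c | R.D => P.n | R.Fc => P.Wf | R.E1 => P.n | R.E2 => P.n | R.TE => P.kE
  | R.U => P.n | R.Bv => P.n | R.E3 => P.n | R.J => P.mR | R.Z => P.Nz | R.Z2 => P.Nz | R.TZ => P.kZ | R.K => P.n | R.D2 => P.n
  | R.Bv2 => P.n | R.E4 => P.n | R.Db => P.n | R.Bc => P.n

/-! ### The oracle blocks -/

/-- The description of an oracle XOR block: kind, block-size field, sources `r₁`, `r₂`, target.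
[cite: BennettBernsteinBrassardVazirani1997, Cor. 4.15] -/
structure Op where
  /-- the kind (tag) of the queries -/
  tag : ℕ
  /-- the field `L` (block size of test controls; `0` if unused) -/
  L : ℕ
  /-- the registers spelling `r₁` -/
  r1 : List R
  /-- the registers spelling `r₂` -/
  r2 : List R
  /-- the target register -/
  dst : R

/-- **The 26 oracle blocks of a copy, in order.** [cite: VanDamSeroussi2002, §4 Algorithm 1] [cite: Kitaev1995, §3, §5] -/
def ops (P : Prm) : List Op :=
  [ ⟨tagFACT, 0, [], [], R.Fc⟩,                    -- 0  Fc ← factCode p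
    ⟨tagSHIFTP, P.BE, [R.TE], [R.E1], R.E2⟩,       -- 1  (mode measurement) E2 ← (E1 + sh) mod p
    ⟨tagUNSHIFTP, P.BE, [R.TE], [R.E2], R.E1⟩,     -- 2  E1 ← 0
    ⟨tagRECONP, P.BE, [R.TE], [], R.U⟩,            -- 3  U ← mode index
    ⟨tagYOFT, 0, [R.T], [], R.Y⟩,                  -- 4  Y ← 1 + t mod (p−1)
    ⟨tagQOFT, 0, [R.T], [], R.Qj⟩,                 -- 5  Qj ← t / (p−1)
    ⟨tagTOFQY, 0, [R.Qj], [R.Y], R.T⟩,             -- 6  T ← 0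
    ⟨tagDLOG, 0, [R.Fc], [R.Y], R.D⟩,              -- 7  D ← dlog Y
    ⟨tagADDEND, 0, [R.S, R.D], [R.U], R.Bv⟩,       -- 8  Bv ← addend
    ⟨tagMODADDP, 0, [R.E2], [R.Bv], R.E3⟩,         -- 9  E3 ← E2 + Bv (kick-back)
    ⟨tagMODSUBP, 0, [R.E3], [R.Bv], R.E2⟩,         -- 10 E2 ← 0
    ⟨tagADDEND, 0, [R.S, R.D], [R.U], R.Bv⟩,       -- 11 Bv ← 0
    ⟨tagDLOG, 0, [R.Fc], [R.Y], R.D⟩,              -- 12 D ← 0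
    ⟨tagADDMUL, 0, [R.Y], [R.J], R.Z⟩,             -- 13 Z ← Y + pJ
    ⟨tagMODP, 0, [R.Z], [], R.Y⟩,                  -- 14 Y ← 0
    ⟨tagDIVP, 0, [R.Z], [], R.J⟩,                  -- 15 J ← 0
    ⟨tagSHIFTQ, P.BZ, [R.TZ], [R.Z], R.Z2⟩,        -- 16 (Fourier read-out) Z2 ← (Z + sh) mod 2^Nz
    ⟨tagUNSHIFTQ, P.BZ, [R.TZ], [R.Z2], R.Z⟩,      -- 17 Z ← 0
    ⟨tagRECONK, P.BZ, [R.TZ], [R.Z2], R.K⟩,        -- 18 K ← character argument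
    ⟨tagDLOG, 0, [R.Fc], [R.K], R.D2⟩,             -- 19 D2 ← dlog K
    ⟨tagADDEND, 0, [R.S, R.D2], [R.U], R.Bv2⟩,     -- 20 Bv2 ← addend
    ⟨tagMODADDP, 0, [R.E3], [R.Bv2], R.E4⟩,        -- 21 E4 ← E3 + Bv2 (un-phase)
    ⟨tagMODSUBP, 0, [R.E4], [R.Bv2], R.E3⟩,        -- 22 E3 ← 0
    ⟨tagADDEND, 0, [R.S, R.D2], [R.U], R.Bv2⟩,     -- 23 Bv2 ← 0
    ⟨tagDLOG, 0, [R.Fc], [R.K], R.D2⟩,             -- 24 D2 ← 0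
    ⟨tagDLOG, 0, [R.Fc], [R.Bc], R.Db⟩ ]           -- 25 Db ← dlog b

/-- There are 26 blocks. [folklore] -/
theorem length_ops (P : Prm) : (ops P).length = 26 := rfl

/-- The total width of a list of registers. [folklore] -/
def wds (P : Prm) (l : List R) : ℕ := (l.map (wd P)).sum

/-- The `w₁` field of a block: the width of `r₁`. [folklore] -/
def Op.w1 (P : Prm) (o : Op) : ℕ := wds P o.r1

/-- **The header string of gate `i` of a block**: its query with empty registers. [cite: VanDamSeroussi2002, §4 Algorithm 1] -/
def hdrStr (P : Prm) (o : Op) (i : ℕ) : List Bool := encodeQ (xOf P.p P.g P.a P.b) o.tag i o.L (o.w1 P) []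

/-- **Queries are headers followed by the register bits.** [folklore] -/
theorem encodeQ_append (x : List Bool) (tag idx L w₁ : ℕ) (regs : List Bool) :
    encodeQ x tag idx L w₁ regs = encodeQ x tag idx L w₁ [] ++ regs := by
  simp [encodeQ, boolPair, List.append_assoc]

/-! ### The segments -/

/-- The header segments of the blocks from position `k` on: for each block, one segment per target bit. [folklore] -/
def hdrSegs (P : Prm) : List Op → List ℕ
  | [] => []
  | o :: os => (List.range (wd P o.dst)).map (fun i => (hdrStr P o i).length) ++ hdrSegs P os

/-- **The segment list of a copy**: the 22 register widths, then the headers. [folklore] -/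
def segs (P : Prm) : List ℕ :=
  wd P R.S :: wd P R.T :: wd P R.Y :: wd P R.Qj :: wd P R.D :: wd P R.Fc :: wd P R.E1 :: wd P R.E2 :: wd P R.TE :: wd P R.U ::
    wd P R.Bv :: wd P R.E3 :: wd P R.J :: wd P R.Z :: wd P R.Z2 :: wd P R.TZ :: wd P R.K :: wd P R.D2 :: wd P R.Bv2 :: wd P R.E4 ::
    wd P R.Db :: wd P R.Bc :: hdrSegs P (ops P)

/-- The number of wires of a copy. [folklore] -/
def bw (P : Prm) : ℕ := (segs P).sum

/-- **The segment of register `r` has its width.** [folklore] -/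
theorem segs_getD_idx (P : Prm) (r : R) : (segs P).getD r.idx 0 = wd P r := by cases r <;> rfl

/-- The first header segment index. [folklore] -/
def hdrBase : ℕ := 22

/-- The header segment index of gate `i` of block number `k`: after the registers and the headers of the earlier blocks. [folklore] -/
def hdrIdx (P : Prm) (k i : ℕ) : ℕ := hdrBase + (((ops P).take k).map fun o => wd P o.dst).sum + i

variable (P : Prm)

/-- **The embedding of register `r`.** [folklore] -/
def reg (r : R) : Fin (wd P r) ↪ Fin (bw P) :=
  ⟨fun i => ⟨pre (segs P) r.idx + i, by
      have h1 := pre_add_le_sum (segs P) r.idx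
      rw [segs_getD_idx] at h1
      have h2 := i.isLt
      unfold bw; omega⟩,
    fun i i' h => Fin.ext (by have := congrArg Fin.val h; simp only at this; omega)⟩

/-- The wire numbers of a register. [folklore] -/
@[simp] theorem reg_val (r : R) (i : Fin (wd P r)) : (reg P r i : ℕ) = pre (segs P) r.idx + i := rfl

/-- The register embedding is the segment embedding. [folklore] -/
theorem reg_eq_emb (r : R) (i : Fin (wd P r)) : reg P r i = emb (segs P) r.idx (Fin.cast (segs_getD_idx P r).symm i) :=
  Fin.ext rfl

/-- **Distinct registers are disjoint.** [folklore] -/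
theorem reg_ne {r r' : R} (h : r ≠ r') (i : Fin (wd P r)) (i' : Fin (wd P r')) : reg P r i ≠ reg P r' i' := by
  intro heq
  have hv := congrArg Fin.val heq
  rw [reg_val, reg_val] at hv
  have hidx : r.idx ≠ r'.idx := fun e => h (R.idx_injective e)
  have h1 := pre_le_emb_val (segs P) r.idx ⟨i, by rw [segs_getD_idx]; exact i.isLt⟩
  have h2 := pre_le_emb_val (segs P) r'.idx ⟨i', by rw [segs_getD_idx]; exact i'.isLt⟩
  simp only [emb_val] at h1 h2
  rcases lt_or_gt_of_ne hidx with hlt | hlt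
  · have := pre_add_le_pre (segs P) hlt; omega
  · have := pre_add_le_pre (segs P) hlt; omega

/-! ### Lists of registers -/

/-- The wires of a duplicate-free list of registers, concatenated, together with the fact that every
wire belongs to a listed register. [folklore] -/
def regsEmbAux : (l : List R) → l.Nodup →
    {e : Fin (wds P l) ↪ Fin (bw P) // ∀ j, ∃ r ∈ l, ∃ i : Fin (wd P r), e j = reg P r i}
  | [], _ => ⟨⟨fun i => Fin.elim0 (by simpa [wds] using i), fun i => Fin.elim0 (by simpa [wds] using i)⟩,
      fun j => Fin.elim0 (by simpa [wds] using j)⟩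
  | r :: l, h =>
    let E := regsEmbAux l (List.nodup_cons.1 h).2
    ⟨catEmb (reg P r) E.1 (fun i j hij => by
        obtain ⟨r', hr', i', hi'⟩ := E.2 j
        exact reg_ne P (fun e => (List.nodup_cons.1 h).1 (by rw [e]; exact hr')) i i' (hij.trans hi')),
      fun j => by
        rcases catEmb_apply_eq (reg P r) E.1 _ j with ⟨i₁, h₁⟩ | ⟨i₂, h₂⟩
        · exact ⟨r, List.mem_cons_self, i₁, h₁⟩
        · obtain ⟨r', hr', i', hi'⟩ := E.2 i₂
          exact ⟨r', List.mem_cons_of_mem _ hr', i', h₂.trans hi'⟩⟩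

/-- **The wires of a duplicate-free list of registers**, concatenated in order. [folklore] -/
def regsEmb (l : List R) (h : l.Nodup) : Fin (wds P l) ↪ Fin (bw P) := (regsEmbAux P l h).1

/-- Every wire of a register list is a wire of a listed register. [folklore] -/
theorem regsEmb_mem (l : List R) (h : l.Nodup) (j : Fin (wds P l)) : ∃ r ∈ l, ∃ i : Fin (wd P r), regsEmb P l h j = reg P r i :=
  (regsEmbAux P l h).2 j

/-- The head register avoids the wires of the tail. [folklore] -/
theorem reg_ne_regsEmb (r : R) (l : List R) (h : (r :: l).Nodup) (i : Fin (wd P r)) (j : Fin (wds P l)) :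
    reg P r i ≠ regsEmb P l (List.nodup_cons.1 h).2 j := by
  obtain ⟨r', hr', i', hi'⟩ := regsEmb_mem P l (List.nodup_cons.1 h).2 j
  rw [hi']
  exact reg_ne P (fun e => (List.nodup_cons.1 h).1 (by rw [e]; exact hr')) i i'

/-- Unfolding the register-list embedding at a cons. [folklore] -/
theorem regsEmb_cons (r : R) (l : List R) (h : (r :: l).Nodup) :
    regsEmb P (r :: l) h = catEmb (reg P r) (regsEmb P l (List.nodup_cons.1 h).2) (reg_ne_regsEmb P r l h) :=
  rfl

/-- **Reading a register list reads the registers in order.** [folklore] -/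
theorem ofFn_comp_regsEmb_cons (r : R) (l : List R) (h : (r :: l).Nodup) (x : QReg (bw P)) :
    List.ofFn (x ∘ regsEmb P (r :: l) h) = List.ofFn (x ∘ reg P r) ++ List.ofFn (x ∘ regsEmb P l (List.nodup_cons.1 h).2) := by
  rw [regsEmb_cons]
  exact ofFn_comp_catEmb _ _ _ x

/-- Reading the empty register list. [folklore] -/
theorem ofFn_comp_regsEmb_nil (h : ([] : List R).Nodup) (x : QReg (bw P)) : List.ofFn (x ∘ regsEmb P [] h) = [] := by
  rw [List.ofFn_eq_nil_iff]
  rfl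

/-! ### Headers -/

/-- The default block (beyond the table). [folklore] -/
def dfltOp : Op := ⟨0, 0, [], [], R.S⟩

/-- Block number `k`. [folklore] -/
def op (k : ℕ) : Op := (ops P).getD k dfltOp

/-- Indexing the header segments of a list of blocks. [folklore] -/
theorem hdrSegs_getD : ∀ (os : List Op) (k : ℕ), k < os.length → ∀ i, i < wd P (os.getD k dfltOp).dst →
    (hdrSegs P os).getD (((os.take k).map fun o => wd P o.dst).sum + i) 0 = (hdrStr P (os.getD k dfltOp) i).length
  | [], k, hk, _, _ => absurd hk (Nat.not_lt_zero _)
  | o :: os, 0, _, i, hi => by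
    have hi' : i < wd P o.dst := by simpa using hi
    rw [hdrSegs, List.take_zero, List.map_nil, List.sum_nil, Nat.zero_add, List.getD_cons_zero,
      List.getD_append _ _ _ _ (by simpa using hi'), List.getD_eq_getElem?_getD, List.getElem?_map, List.getElem?_range hi']
    rfl
  | o :: os, k + 1, hk, i, hi => by
    have hi' : i < wd P (os.getD k dfltOp).dst := by simpa using hi
    have ih := hdrSegs_getD os k (by simpa using hk) i hi'
    rw [List.getD_cons_succ, hdrSegs]
    have e : (((o :: os).take (k + 1)).map fun o => wd P o.dst).sum + i =
        ((List.range (wd P o.dst)).map fun i => (hdrStr P o i).length).length + ((((os.take k).map fun o => wd P o.dst).sum) + i) := by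
      simp [List.take_succ_cons]; omega
    rw [e, List.getD_append_right _ _ _ _ (Nat.le_add_right _ _), Nat.add_sub_cancel_left]
    exact ih

/-- **The header segment of gate `i` of block `k` has the length of its header string.** [folklore] -/
theorem segs_getD_hdrIdx {k : ℕ} (hk : k < 26) {i : ℕ} (hi : i < wd P (op P k).dst) :
    (segs P).getD (hdrIdx P k i) 0 = (hdrStr P (op P k) i).length := by
  have h := hdrSegs_getD P (ops P) k (by rw [length_ops]; exact hk) i hi
  have e : hdrIdx P k i = ((((ops P).take k).map fun o => wd P o.dst).sum + i) + 22 := by unfold hdrIdx hdrBase; omega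
  rw [e]
  exact h

/-- Header segments come after the registers. [folklore] -/
theorem le_hdrIdx (k i : ℕ) : 22 ≤ hdrIdx P k i := by unfold hdrIdx hdrBase; omega

/-- **The header wires of gate `i` of block `k`.** [folklore] -/
def hdr (k i : ℕ) : Fin ((segs P).getD (hdrIdx P k i) 0) ↪ Fin (bw P) := emb (segs P) (hdrIdx P k i)

/-- Header wires avoid register wires. [folklore] -/
theorem hdr_ne_reg (k i : ℕ) (a : Fin ((segs P).getD (hdrIdx P k i) 0)) (r : R) (j : Fin (wd P r)) : hdr P k i a ≠ reg P r j := by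
  rw [reg_eq_emb]
  exact emb_ne (segs P) (fun e => by have := le_hdrIdx P k i; have := R.idx_lt r; omega) a _

/-- Header wires avoid the wires of register lists. [folklore] -/
theorem hdr_ne_regsEmb (k i : ℕ) (a : Fin ((segs P).getD (hdrIdx P k i) 0)) (l : List R) (h : l.Nodup) (j : Fin (wds P l)) :
    hdr P k i a ≠ regsEmb P l h j := by
  obtain ⟨r, -, i', hi'⟩ := regsEmb_mem P l h j
  rw [hi']
  exact hdr_ne_reg P k i a r i'

/-! ### The oracle XOR blocks -/

/-- The register lists of every block, with its target, are duplicate-free. [folklore] -/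
theorem op_nodup (k : ℕ) : ((op P k).r1 ++ (op P k).r2 ++ [(op P k).dst]).Nodup := by
  rcases Nat.lt_or_ge k 26 with hk | hk
  · interval_cases k <;> simp only [op, ops, List.getD_cons_zero, List.getD_cons_succ] <;> decide
  · have : op P k = dfltOp := by
      unfold op
      exact List.getD_eq_default _ _ (by rw [length_ops]; exact hk)
    rw [this]; decide

/-- Sources of a block are duplicate-free. [folklore] -/
theorem src_nodup (k : ℕ) : ((op P k).r1 ++ (op P k).r2).Nodup := (List.nodup_append.1 (op_nodup P k)).1

/-- The target of a block is not a source. [folklore] -/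
theorem dst_not_mem_src (k : ℕ) : (op P k).dst ∉ (op P k).r1 ++ (op P k).r2 := by
  intro hm
  exact (List.nodup_append.1 (op_nodup P k)).2.2 _ hm _ (List.mem_singleton_self _) rfl

/-- **The oracle XOR block number `k` of the copy** (gate `i` reads its header, then `r₁ ++ r₂`, and
answers on wire `i` of the target register). [cite: BennettBernsteinBrassardVazirani1997, Cor. 4.15] -/
def xblock (k : ℕ) : OracleXor.XBlock (bw P) where
  n := wd P (op P k).dst
  hl i := (segs P).getD (hdrIdx P k i) 0
  hdr i := hdr P k i
  s := wds P ((op P k).r1 ++ (op P k).r2)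
  src := regsEmb P ((op P k).r1 ++ (op P k).r2) (src_nodup P k)
  dst := reg P (op P k).dst
  hhs i a b := hdr_ne_regsEmb P k i a _ _ b
  hht i a j := hdr_ne_reg P k i a _ j
  hst b j := by
    obtain ⟨r, hr, i', hi'⟩ := regsEmb_mem P _ (src_nodup P k) b
    rw [hi']
    exact reg_ne P (fun e => dst_not_mem_src P k (by rw [← e]; exact hr)) i' j

end VDSCopy

end Literature.Computability.Cryptography

end
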